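import Summits.AtomisticToContinuum.Crystallization.Theorems.FrustratedLawDichotomyDRowsBccTemplate

/-!
# DROWS-SOUND, bcc: the finite counting fact FIBRES, and the unconditional bcc row floor

decomp-a2c hand-2 g46 — structural share for `AperiodicFrustratedLawGap` (stmt-27623), class-D rows (critic r1757 (C)(b) «DROWS-SOUND»).
`…DRowsBccTemplate.bcc_rootEnergy_floor_of_fibres` takes ONE finite hypothesis, FIBRES: every shell `(D, m)` of census's certified histogram `H0`
carries exactly `m` nonzero points of the bcc parity frame in the box `[-19,19]³`.  A direct `decide` on `Finset.filter/card` stalls, so the count is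
done here the K way: ONE pass over an explicit list of the box (`boxL`) building an association-list histogram (`histL`, via `incr`), checked against
`H0` by a single closed `decide +kernel` (`histOK`), together with the SYMBOLIC correctness of that pass (`look_histL` : the histogram entry IS the
count) and the dictionary between the list `boxL` and the `Finset` `bccBox` of (s1) (`mem_boxL`, `boxL_nodup`, `card_filter_bccBox`).

★ `fibres_H0` (FIBRES, proved) and ★★ `bcc_rootEnergy_floor` — UNCONDITIONAL: for every leaf `i < 128` and every `s ∈ [sNum i/sDen, sNum (i+1)/sDen]`
(`s/s⋆ ∈ [0.94, 1.06]`), `e⋆ + 27/1000 ≤ rootEnergy V_LJ (count⌊bccTemplate s)`.  This CLOSES DROWS-SOUND for the bcc chunk: the perfect bcc template is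
not a Lennard-Jones minimiser anywhere on its scale window, as a theorem about the tree's `rootEnergy` resting on census's kernel certificate (233).
-/

namespace Summit.AtomisticToContinuum.Crystallization.Theorems.FrustratedLawDichotomyDRowsBccFibres

open MeasureTheory
open Literature.MathematicalPhysics.StatisticalMechanics (lennardJones rootEnergy)
open Summit.AtomisticToContinuum.Crystallization.Theorems.ChargedEnergyGapNegative (E3 eStar)
open Summit.AtomisticToContinuum.Crystallization.Theorems.FrustratedLawDichotomyDRowsBcc (H0 sNum sDen)
open Summit.AtomisticToContinuum.Crystallization.Theorems.FrustratedLawDichotomyDRowsBccTemplate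
  (bccTemplate nsq bccBox bcc_rootEnergy_floor_of_fibres)

/-! ## §1 The one-pass histogram (K side) -/

/-- the coordinate list `[-19, …, 19]`. -/
def coordsL : List ℤ := (List.range 39).map fun n : ℕ => (n : ℤ) - 19

/-- the nonzero parity points of the box, as an explicit list (same predicate as `bccBox`). -/
def boxL : List (ℤ × ℤ × ℤ) :=
  (coordsL.flatMap fun a => coordsL.flatMap fun b => coordsL.map fun c => (a, b, c)).filter
    fun m => decide ((m.1 % 2 = m.2.1 % 2 ∧ m.2.1 % 2 = m.2.2 % 2) ∧ m ≠ 0)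

/-- bump the count of key `D` in an association list (appending a fresh entry at the end). -/
def incr : List (ℤ × ℕ) → ℤ → List (ℤ × ℕ)
  | [], D => [(D, 1)]
  | (D', c) :: t, D => if D' = D then (D', c + 1) :: t else (D', c) :: incr t D

/-- the entry of key `D` (zero if absent). -/
def look : List (ℤ × ℕ) → ℤ → ℕ
  | [], _ => 0
  | (D', c) :: t, D => if D' = D then c else look t D

/-- the histogram of squared lengths of a list of triples. -/
def histL (L : List (ℤ × ℤ × ℤ)) : List (ℤ × ℕ) := L.foldl (fun h m => incr h (nsq m)) []

/-- ★ (K) the one-pass histogram of the box points of squared length `< 375` agrees with census's `H0` on every booked shell. -/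
theorem histOK : (H0.all fun Dm => look (histL (boxL.filter fun m => decide (nsq m < 375))) (Dm.1 : ℤ) == Dm.2) = true := by
  decide +kernel

/-! ## §2 Correctness of the pass -/

/-- `look` after `incr`. -/
theorem look_incr (h : List (ℤ × ℕ)) (D D' : ℤ) : look (incr h D) D' = look h D' + if D = D' then 1 else 0 := by
  induction h with
  | nil => simp [incr, look]
  | cons e t ih =>
    obtain ⟨D'', c⟩ := e
    by_cases h1 : D'' = D
    · subst h1
      by_cases h2 : D'' = D'
      · simp [incr, look, h2]
      · simp [incr, look, h2]
    · by_cases h2 : D'' = D'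
      · subst h2
        have h3 : ¬D = D'' := fun h => h1 h.symm
        simp [incr, look, h1, h3]
      · simp [incr, look, h1, h2, ih]

/-- ★ the histogram entry of `D` IS the number of list elements of squared length `D`. -/
theorem look_histL (L : List (ℤ × ℤ × ℤ)) (D : ℤ) : look (histL L) D = L.countP fun m => decide (nsq m = D) := by
  suffices h : ∀ (acc : List (ℤ × ℕ)), look (L.foldl (fun h m => incr h (nsq m)) acc) D = look acc D + L.countP fun m => decide (nsq m = D) by
    simpa [histL, look] using h []
  induction L with
  | nil => intro acc; simp
  | cons m t ih =>
    intro acc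
    rw [List.foldl_cons, ih, look_incr, List.countP_cons]
    by_cases hm : nsq m = D
    · simp [hm]; omega
    · simp [hm]

/-! ## §3 The dictionary `boxL` ↔ `bccBox` -/

/-- membership in the coordinate list. -/
theorem mem_coordsL {a : ℤ} : a ∈ coordsL ↔ -19 ≤ a ∧ a ≤ 19 := by
  simp only [coordsL, List.mem_map, List.mem_range]
  constructor
  · rintro ⟨n, hn, rfl⟩; omega
  · rintro ⟨h1, h2⟩; exact ⟨(a + 19).toNat, by omega, by omega⟩

/-- the list and the `Finset` have the same members. -/
theorem mem_boxL {m : ℤ × ℤ × ℤ} : m ∈ boxL ↔ m ∈ bccBox := by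
  obtain ⟨a, b, c⟩ := m
  simp only [boxL, bccBox, List.mem_filter, List.mem_flatMap, List.mem_map, decide_eq_true_eq, Finset.mem_filter,
    Finset.mem_product, Finset.mem_Icc, mem_coordsL, Prod.mk.injEq]
  constructor
  · rintro ⟨⟨a', ha', b', hb', c', hc', rfl, rfl, rfl⟩, hp⟩
    exact ⟨⟨ha', hb', hc'⟩, hp⟩
  · rintro ⟨⟨ha, hb, hc⟩, hp⟩
    exact ⟨⟨a, ha, b, hb, c, hc, rfl, rfl, rfl⟩, hp⟩

/-- the coordinate list has no duplicates. -/
theorem coordsL_nodup : coordsL.Nodup := by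
  refine (List.nodup_range).map fun x y h => ?_
  simpa using h

/-- the box list has no duplicates. -/
theorem boxL_nodup : boxL.Nodup := by
  refine List.Nodup.filter _ ?_
  rw [List.nodup_flatMap]
  refine ⟨fun a _ => ?_, ?_⟩
  · rw [List.nodup_flatMap]
    refine ⟨fun b _ => (coordsL_nodup).map fun x y h => by simpa using h, ?_⟩
    refine coordsL_nodup.pairwise_of_forall_ne fun b _ b' _ hbb' => ?_
    simp only [Function.onFun, List.disjoint_left, List.mem_map]
    rintro _ ⟨c, -, rfl⟩ ⟨c', -, h⟩
    simp only [Prod.mk.injEq] at h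
    exact hbb' h.2.1.symm
  · refine coordsL_nodup.pairwise_of_forall_ne fun a _ a' _ haa' => ?_
    simp only [Function.onFun, List.disjoint_left, List.mem_flatMap, List.mem_map]
    rintro _ ⟨b, -, c, -, rfl⟩ ⟨b', -, c', -, h⟩
    simp only [Prod.mk.injEq] at h
    exact haa' h.1.symm

/-- ★ `Finset` counts over `bccBox` are list counts over `boxL`. -/
theorem card_filter_bccBox (p : ℤ × ℤ × ℤ → Prop) [DecidablePred p] :
    (bccBox.filter p).card = (boxL.filter fun m => decide (p m)).length := by
  classical
  have hset : bccBox.filter p = (boxL.filter fun m => decide (p m)).toFinset := by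
    ext m
    simp only [Finset.mem_filter, List.mem_toFinset, List.mem_filter, decide_eq_true_eq, mem_boxL]
  rw [hset, List.toFinset_card_of_nodup (boxL_nodup.filter _)]

/-! ## §4 ★ FIBRES and the unconditional floor -/

/-- ★ **FIBRES**: every shell `(D, m)` booked in census's `H0` carries exactly `m` nonzero frame points of squared length `D` in `[-19,19]³`. -/
theorem fibres_H0 : ∀ Dm ∈ H0, (bccBox.filter fun m => nsq m = (Dm.1 : ℤ)).card = Dm.2 := by
  intro Dm hDm
  have hall := List.all_eq_true.mp histOK Dm hDm
  simp only [beq_iff_eq] at hall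
  have hD : ∀ Dm ∈ H0, Dm.1 < 375 := by decide +kernel
  have hlt : (Dm.1 : ℤ) < 375 := by exact_mod_cast hD Dm hDm
  rw [card_filter_bccBox, ← hall, look_histL, List.countP_eq_length_filter, List.filter_filter]
  refine congrArg List.length (List.filter_congr fun m _ => ?_)
  by_cases h : nsq m = (Dm.1 : ℤ)
  · simp [h, hlt]
  · simp [h]

/-- ★★★ **DROWS-SOUND, bcc — UNCONDITIONAL.**  For every leaf `i < 128` and every nearest-neighbour distance `s ∈ [sNum i/sDen, sNum (i+1)/sDen]`
(together `s/s⋆ ∈ [0.94, 1.06]`, `s⋆ = 0.95192`): `e⋆ + 27/1000 ≤ rootEnergy V_LJ (count⌊bccTemplate s)` — the perfect bcc template is not a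
Lennard-Jones minimiser anywhere on its scale window. [this route] -/
theorem bcc_rootEnergy_floor {i : ℕ} (hi : i < 128) {s : ℝ} (hs1 : (sNum i : ℝ) / sDen ≤ s) (hs2 : s ≤ (sNum (i + 1) : ℝ) / sDen) :
    eStar + 27 / 1000 ≤ rootEnergy lennardJones (Measure.count.restrict (bccTemplate s) : Measure E3) :=
  bcc_rootEnergy_floor_of_fibres fibres_H0 hi hs1 hs2

end Summit.AtomisticToContinuum.Crystallization.Theorems.FrustratedLawDichotomyDRowsBccFibres
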